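import Literature.AlgebraicGeometry.Resolution.ArithmeticalThreefoldsLocalDescentDecompositionHead
import Literature.AlgebraicGeometry.Resolution.Prop81HeadOfGlue
import HarnessLib

/-!
# Cossart–Piltant 2019, (C4) `CossartPiltant2019ReductionP`: the chain with the head of [CoP1] Prop. 9.3 DISCHARGED modulo monomialization with denominator control

Topic: `Literature/AlgebraicGeometry/Resolution`. PROOF side of `CossartPiltant2019ReductionP`
(`ArithmeticalThreefoldsLocal.lean`), input (C4). In
`cossartPiltant2019ReductionP_of_cjs_of_stableInertia_of_head`
(`ArithmeticalThreefoldsLocalDescentDecompositionHead.lean`) the head of the decomposition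
layer of [CoP1] Prop. 9.3 — [CoP1] Prop. 8.1 (1)–(2) in the model reading plus the choice
(46) — is the hypothesis `hHead`. By `head_conclusion_of_monomialization`
(`Prop81HeadOfGlue.lean`) `hHead` follows from the hypotheses `CossartPiltant2019Principalization`
and `hEmb` already present in the chain and ONE hypothesis `hMono`: the model form of
[CoP1] Prop. 4.1 for one element along the valuation (a finer local uniformization in which
a given element is a monomial) WITH the denominator clause of property (1) — the new
generators are quotients of elements of the old local ring by divisors of powers of the
element (what the embedded resolution of its zero locus, an isomorphism off it, provides).
This file records the resulting chain
`CossartPiltant2019Local → CossartPiltant2019Principalization → CossartJannsenSaito2020General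
→ hEmb → hStabLoc → hStabIη → hMono → CossartPiltant2019ReductionP`
(`cossartPiltant2019ReductionP_of_cjs_of_stableInertia_of_monomialization`).

Everything is PROVED; no named facts, definitions, instances or notation are introduced.

## Sources

* V. Cossart, O. Piltant, J. Algebra 529 (2019): Props. 4.3, 4.4 and proof of Prop. 4.10
  (arXiv v1: Props. 4.2, 4.3, 4.8). [CossartPiltant2019]
* V. Cossart, O. Piltant, J. Algebra 320 (2008): Prop. 4.1, Prop. 8.1, Prop. 9.3 and their
  proofs (HAL hal-00139124, pp. 6–7, 22–23, 26–30). [CossartPiltant2008]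
-/

noncomputable section

open CategoryTheory AlgebraicGeometry TopologicalSpace IsLocalRing _root_.Polynomial
  _root_.IntermediateField

namespace Literature.AlgebraicGeometry.Resolution

universe u

set_option maxHeartbeats 800000 in
/-- **The chain for (C4) with the head of [CoP1] Prop. 9.3 replaced by monomialization with
denominator control** (`hMono`, see the module docstring); all of [CoP1] Prop. 8.1 after the
principalization stage, the choice (46), property (1) and the extraction of the head are
discharged by `head_conclusion_of_monomialization`.
[cite: CossartPiltant2019, Props. 4.3, 4.4 and proof of Prop. 4.10 (arXiv v1: Props. 4.2, 4.3, 4.8, pp. 50–54)]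
[cite: CossartPiltant2008, Prop. 4.1, Prop. 8.1, Prop. 9.3 and their proofs (HAL pp. 6–7, 22–23, 26–30)] -/
theorem cossartPiltant2019ReductionP_of_cjs_of_stableInertia_of_monomialization
    (hloc : CossartPiltant2019Local.{u}) (h44 : CossartPiltant2019Principalization.{u})
    (hCJS : CossartJannsenSaito2020General.{u})
    (hEmb : ∀ (Z : Scheme.{u}) [IsIntegral Z] [IsNoetherian Z], Scheme.IsRegular Z →
      Scheme.IsExcellent Z → ∀ (X : Set Z), IsClosed X → X ≠ Set.univ → topologicalKrullDim X ≤ 2 →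
        ∃ (Z' : Scheme.{u}) (π : Z' ⟶ Z), IsProper π ∧ Function.Surjective π.base ∧
          (∃ U : Z.Opens, (U : Set Z) = Xᶜ ∧ IsIso (π ∣_ U)) ∧
          IsStrictNormalCrossingsDivisor Z' (π.base ⁻¹' X))
    (hStabLoc :
      ∀ (p : ℕ), p.Prime →
      ∀ (S : Type u) [CommRing S] [IsDomain S] [IsRegularLocalRing S],
        IsExcellentRing S → ringKrullDim S = 3 → CharP (ResidueField S) p →
        IsAdicComplete (maximalIdeal S) S →
      ∀ (E : Type u) [Field E] [Algebra S E], Function.Injective (algebraMap S E) →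
        IsAlgClosed E → Algebra.IsAlgebraic S E →
      ∀ (OE : ValuationSubring E), (∀ s : S, algebraMap S E s ∈ OE) →
        (∀ s ∈ maximalIdeal S, OE.valuation (algebraMap S E s) < 1) →
        (∀ y : OE, ∃ q : S[X], (∃ i, q.coeff i ∉ maximalIdeal S) ∧
          OE.valuation (q.eval₂ (algebraMap S E) y) < 1) →
      Nonempty OE.valuation.RankOne →
      ∀ (ℓ : ℕ), ℓ.Prime → ℓ ≠ p → ∀ (ζ : E), IsPrimitiveRoot ζ ℓ →
      ∀ (A : Subfield E), (∀ s : S, algebraMap S E s ∈ A) → ζ ∈ A →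
      ∀ (θ : E), θ ∉ A → θ ^ ℓ ∈ A → OE.valuation θ ≤ 1 →
        Module.finrank A (adjoin A ({θ} : Set E)) = ℓ → IsGalois A (adjoin A ({θ} : Set E)) →
        inertiaGroupIn OE (adjoin A ({θ} : Set E)) = ⊤ →
        (∃ t : Finset E, (t : Set E) ⊆ (adjoin A ({θ} : Set E)).toSubfield ∧
          (adjoin A ({θ} : Set E)).toSubfield ≤
            Subfield.closure (Set.range (algebraMap S E) ∪ (t : Set E)) ∧
          ∃ hTO : (Algebra.adjoin S (t : Set E)).toSubring ≤ OE.toSubring,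
            IsRegularLocalRing (Localization.AtPrime
              (Ideal.comap (Subring.inclusion hTO) (maximalIdeal OE)))) →
        (∃ t : Finset E, (t : Set E) ⊆ (adjoin A ({θ} : Set E)).toSubfield ∧
          (adjoin A ({θ} : Set E)).toSubfield ≤
            Subfield.closure (Set.range (algebraMap S E) ∪ (t : Set E)) ∧
          ∃ hTO : (Algebra.adjoin S (t : Set E)).toSubring ≤ OE.toSubring,
            IsRegularLocalRing (Localization.AtPrime
              (Ideal.comap (Subring.inclusion hTO) (maximalIdeal OE))) ∧
            ∀ (τ : adjoin A ({θ} : Set E) ≃ₐ[A] adjoin A ({θ} : Set E))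
              (x : adjoin A ({θ} : Set E)),
              (x : E) ∈ locAtCentre (Algebra.adjoin S (t : Set E)).toSubring OE →
              ((τ x : adjoin A ({θ} : Set E)) : E) ∈
                locAtCentre (Algebra.adjoin S (t : Set E)).toSubring OE))
    (hStabIη :
      ∀ (p : ℕ), p.Prime →
      ∀ (S : Type u) [CommRing S] [IsDomain S] [IsRegularLocalRing S],
        IsExcellentRing S → ringKrullDim S = 3 → CharP (ResidueField S) p →
        IsAdicComplete (maximalIdeal S) S →
      ∀ (E : Type u) [Field E] [Algebra S E], Function.Injective (algebraMap S E) →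
        IsAlgClosed E → Algebra.IsAlgebraic S E →
      ∀ (OE : ValuationSubring E), (∀ s : S, algebraMap S E s ∈ OE) →
        (∀ s ∈ maximalIdeal S, OE.valuation (algebraMap S E s) < 1) →
        (∀ y : OE, ∃ q : S[X], (∃ i, q.coeff i ∉ maximalIdeal S) ∧
          OE.valuation (q.eval₂ (algebraMap S E) y) < 1) →
      Nonempty OE.valuation.RankOne →
      ∀ (M : Subfield E), (∀ s : S, algebraMap S E s ∈ M) →
      ∀ (N : IntermediateField M E) [FiniteDimensional M N] [IsGalois M N],
      ∀ (η : E), η ∈ OE → η ∈ (lift (fixedField (inertiaGroupIn OE N))).toSubfield →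
        (∃ F : Polynomial E, F.Monic ∧
          (∀ k, F.coeff k ∈ OE ∧
            F.coeff k ∈ (lift (fixedField (decompositionGroupIn OE N))).toSubfield) ∧
          F.eval η = 0 ∧ OE.valuation ((derivative F).eval η) = 1) →
        (lift (fixedField (inertiaGroupIn OE N))).toSubfield =
          (IntermediateField.adjoin (lift (fixedField (decompositionGroupIn OE N))).toSubfield
            ({η} : Set E)).toSubfield →
        (∃ t : Finset E, (t : Set E) ⊆ (lift (fixedField (inertiaGroupIn OE N))).toSubfield ∧
          (lift (fixedField (inertiaGroupIn OE N))).toSubfield ≤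
            Subfield.closure (Set.range (algebraMap S E) ∪ (t : Set E)) ∧
          ∃ hTO : (Algebra.adjoin S (t : Set E)).toSubring ≤ OE.toSubring,
            IsRegularLocalRing (Localization.AtPrime
              (Ideal.comap (Subring.inclusion hTO) (maximalIdeal OE)))) →
        ∃ t : Finset E, (t : Set E) ⊆ (lift (fixedField (inertiaGroupIn OE N))).toSubfield ∧
          (lift (fixedField (inertiaGroupIn OE N))).toSubfield ≤
            Subfield.closure (Set.range (algebraMap S E) ∪ (t : Set E)) ∧
          ∃ hTO : (Algebra.adjoin S (t : Set E)).toSubring ≤ OE.toSubring,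
            IsRegularLocalRing (Localization.AtPrime
              (Ideal.comap (Subring.inclusion hTO) (maximalIdeal OE))) ∧
            (∀ τ ∈ decompositionGroupIn OE N, ∀ x : N,
              (x : E) ∈ locAtCentre (Algebra.adjoin S (t : Set E)).toSubring OE →
              ((τ x : N) : E) ∈ locAtCentre (Algebra.adjoin S (t : Set E)).toSubring OE) ∧
            η ∈ locAtCentre (Algebra.adjoin S (t : Set E)).toSubring OE)
    (hMono :
      ∀ (p : ℕ), p.Prime →
      ∀ (S : Type u) [CommRing S] [IsDomain S] [IsRegularLocalRing S],
        IsExcellentRing S → ringKrullDim S = 3 → CharP (ResidueField S) p →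
        IsAdicComplete (maximalIdeal S) S →
      ∀ (E : Type u) [Field E] [Algebra S E], Function.Injective (algebraMap S E) →
        IsAlgClosed E → Algebra.IsAlgebraic S E →
      ∀ (OE : ValuationSubring E), (∀ s : S, algebraMap S E s ∈ OE) →
        (∀ s ∈ maximalIdeal S, OE.valuation (algebraMap S E s) < 1) →
        (∀ y : OE, ∃ q : S[X], (∃ i, q.coeff i ∉ maximalIdeal S) ∧
          OE.valuation (q.eval₂ (algebraMap S E) y) < 1) →
      Nonempty OE.valuation.RankOne →
      ∀ (M : Subfield E), (∀ s : S, algebraMap S E s ∈ M) →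
      ∀ (N : IntermediateField M E) [FiniteDimensional M N] [IsGalois M N] (K' : Subfield E),
        M ≤ K' → K' ≤ (lift (fixedField (decompositionGroupIn OE N))).toSubfield →
        (∃ t : Finset E, (t : Set E) ⊆ K' ∧
          K' ≤ Subfield.closure (Set.range (algebraMap S E) ∪ (t : Set E)) ∧
          ∃ hTO : (Algebra.adjoin S (t : Set E)).toSubring ≤ OE.toSubring,
            IsRegularLocalRing (Localization.AtPrime
              (Ideal.comap (Subring.inclusion hTO) (maximalIdeal OE)))) →
      ∀ (t : Finset E), (t : Set E) ⊆ K' →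
        ∀ hTO : (Algebra.adjoin S (t : Set E)).toSubring ≤ OE.toSubring,
        IsRegularLocalRing (locAtCentre (Algebra.adjoin S (t : Set E)).toSubring OE) →
        ∀ G : E, G ∈ locAtCentre (Algebra.adjoin S (t : Set E)).toSubring OE → G ≠ 0 →
          OE.valuation G < 1 →
        ∃ t' : Finset E, t ⊆ t' ∧ (t' : Set E) ⊆ K' ∧
          ∃ hT'O : (Algebra.adjoin S (t' : Set E)).toSubring ≤ OE.toSubring,
          IsRegularLocalRing (locAtCentre (Algebra.adjoin S (t' : Set E)).toSubring OE) ∧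
          ∃ (x : Fin 3 → locAtCentre (Algebra.adjoin S (t' : Set E)).toSubring OE) (u : E)
            (α : Fin 3 → ℕ),
            (haveI := isLocalRing_locAtCentre hT'O
             Ideal.span (Set.range x) = maximalIdeal _) ∧
            u ∈ locAtCentre (Algebra.adjoin S (t' : Set E)).toSubring OE ∧ OE.valuation u = 1 ∧
            G = u * ∏ c, (x c : E) ^ α c ∧
            ∀ z ∈ (t' : Set E), ∃ a b : E,
              a ∈ locAtCentre (Algebra.adjoin S (t : Set E)).toSubring OE ∧
              b ∈ locAtCentre (Algebra.adjoin S (t : Set E)).toSubring OE ∧ a ≠ 0 ∧ z * a = b ∧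
              ∃ (N : ℕ) (c : E), c ∈ locAtCentre (Algebra.adjoin S (t' : Set E)).toSubring OE ∧
                G ^ N = a * c) :
    CossartPiltant2019ReductionP.{u} :=
  cossartPiltant2019ReductionP_of_cjs_of_stableInertia_of_head hloc h44 hCJS hEmb hStabLoc hStabIη
    (fun p hp S _ _ _ hS hSdim hSchar hScomp E _ _ hinj hE halg OE hSO hdom hres hrk M hSM N _ _ K'
        hMK' hK'Z hLUK' t₁ ht₁M _ ht₁O _ t₁' ht₁'K' hext₁ => by
      haveI := halg
      exact head_conclusion_of_monomialization h44 hEmb hS hSdim hinj OE hSO hdom hres hrk M K' hSM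
        hMK' hLUK' t₁ ht₁M ht₁O t₁' ht₁'K' hext₁
        (hMono p hp S hS hSdim hSchar hScomp E hinj hE halg OE hSO hdom hres hrk M hSM N K' hMK'
          hK'Z hLUK'))

end Literature.AlgebraicGeometry.Resolution

end
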